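import Summits.Parity.GeneralizedHardyLittlewood.Theorems.PrimeLevelFamEdgeMomentsBeyondDiagonalDiagDecorOrderOneThreeAssembly
import Summits.Parity.GeneralizedHardyLittlewood.Theorems.PrimeLevelFamEdgeMomentsBeyondDiagonalDiagDecorOrderOneThreePoly
import HarnessLib

/-!
# Route `PrimeLevelFamEdge`, crux K_A `MomentsBeyondDiagonal` (stmt-Parity-20007), line «petersson_layers» v4, stub `stub_diag`:
# **THE ORDER-`(1,3)` TARGET MODULO THE SINGLE INPUT (R₁₃)** — composition of (Poly₁₃) (`…DiagDecorOrderOneThreePoly`,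
# unconditional) with `…DiagDecorOrderOneThreeAssembly.orderOneThree_target_of_poly_of_remainder`

* `orderOneThree_target_of_remainder` — **(R₁₃) ⟹ the order-`(1,3)` target** of
  `…DiagOrderSymm.subDiag_of_selbergOrderAsymptotics_of_le` (`i = 1`, `j = 3`, any window `(1,Δ]`), with the level-free functional
  `τ₁₃(Δ′,P) = Δ′²·(Δ′²𝔎₁₃(1/Δ′,P))/(2(π²/6)²)`, `𝔎₁₃(λ,P) = (π²/6)²(Φ₅(λ,P)/160 − (3/16)Ξ₁(λ,P))` (`Φ_m`, `Ξ_m` the block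
  functionals of `…DiagDecorShiftedLpow` / `…DiagDecorShiftedP2P2Lpow`).

So after this file rung `N = 3` of `stub_diag` (orders `(1,3)`, `(3,3)` on top of rung 2) needs: (R₂₂) [famedge-1, in progress],
(R₁₃) [the Bose remainders `r_ab`, `a + b ≤ 4`, `a ≤ 1` — the SAME bricks as (R₂₂) up to the index set], and the order-`(3,3)` chain
(Hecke weight landed in `…DiagDecorOrderRungThreeHecke`; its poly part needs the `M₆` family [landed] and a crude two-sided
`M₄ ⊗ P₂` block [open], its remainder (R₃₃) the Bose remainders with `a + b ≤ 6`).

Def-free; theorems only. Helper `--supports stmt-Parity-20007`; closes nothing; K_A, K_B and the Parity summit are NOT proved;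
nothing about Landau–Siegel zeros.

## References
* E. Kowalski, P. Michel, J. VanderKam, J. reine angew. Math. 526 (2000), (23)–(28) pp. 13–15 and Prop. 5.1 p. 18.
  [cite: KowalskiMichelVanderKam2000, (23)–(28) — derivation (order-(1,3) piece of the diagonal main term, general Q)]
-/

noncomputable section

open scoped Real ArithmeticFunction.Moebius
open Finset ArithmeticFunction Polynomial MeasureTheory Set

namespace Summit.Parity.GeneralizedHardyLittlewood.Theorems.MomentsBeyondDiagonal.DiagKernel

open Literature.NumberTheory.LFunctions Literature.NumberTheory.LFunctions.KMV2000

set_option maxHeartbeats 800000 in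
-- large statement (one verbatim analytic hypothesis, two closed-form functionals)
/-- **(R₁₃) ⟹ THE ORDER-`(1,3)` TARGET** (window `(1,Δ]`, any `Δ`; see the module docstring).
[cite: KowalskiMichelVanderKam2000, (23)–(28) and Prop. 5.1 — derivation] -/
theorem orderOneThree_target_of_remainder {Δ : ℝ}
    (hR : ∃ E₀₀ E₀₁ E₀₂ E₀₃ E₁₀ E₁₁ E₁₂ E₁₃ μ₂ μ₄ : ℝ, ∀ P : ℝ[X], KMV2000.Admissible P → ∀ Δ' : ℝ, 1 < Δ' → Δ' ≤ Δ →
      ∃ C : ℝ, ∃ q₀ : ℕ, ∀ (q : ℕ) [NeZero q], q₀ ≤ q →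
        |∑ c ∈ Icc 1 ⌊qhat q ^ Δ'⌋₊, ∑ g ∈ Icc 1 (⌊qhat q ^ Δ'⌋₊ / c), (μ g : ℝ) * c *
        ∑ k₁ ∈ Icc 1 (⌊qhat q ^ Δ'⌋₊ / (c * g)), ∑ k₂ ∈ Icc 1 (⌊qhat q ^ Δ'⌋₊ / (c * g)),
          ((μ (c * g * k₁) : ℝ) * ((psi (c * g * k₁))⁻¹ *
              P.eval (Real.log (qhat q ^ Δ' / ((c * g * k₁ : ℕ) : ℝ)) / Real.log (qhat q ^ Δ'))) / ((c * g * k₁ : ℕ) : ℝ)) *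
            ((μ (c * g * k₂) : ℝ) * ((psi (c * g * k₂))⁻¹ *
              P.eval (Real.log (qhat q ^ Δ' / ((c * g * k₂ : ℕ) : ℝ)) / Real.log (qhat q ^ Δ'))) / ((c * g * k₂ : ℕ) : ℝ)) *
            ((k₁.divisors.card : ℝ) * (k₂.divisors.card : ℝ) *
          (((2 * (Real.log (qhat q) - Real.log g) - Real.log k₁ - Real.log k₂) ^ 4 -
                3 * ((∑ p ∈ k₁.primeFactors, Real.log p ^ 2) + ∑ p ∈ k₂.primeFactors, Real.log p ^ 2) ^ 2 +
                2 * ((∑ p ∈ k₁.primeFactors, Real.log p ^ 4) + ∑ p ∈ k₂.primeFactors, Real.log p ^ 4)) / 16 *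
              ((∫ u₁ in Ioi (0 : ℝ), ∫ u₂ in Ioi ((((g * g * (k₁ * k₂) : ℕ) : ℝ) / qhat q ^ 2) / u₁),
              Real.exp (-(u₁ + u₂)) / (1 - Real.exp (-(u₁ + u₂))) ^ 2) -
                  (Real.log (qhat q ^ 2 / ((g * g * (k₁ * k₂) : ℕ) : ℝ)) / 2 + E₀₀)) +
            (3 * (2 * (Real.log (qhat q) - Real.log g) - Real.log k₁ - Real.log k₂) ^ 3 -
                3 * (2 * (Real.log (qhat q) - Real.log g) - Real.log k₁ - Real.log k₂) * ((∑ p ∈ k₁.primeFactors, Real.log p ^ 2) + ∑ p ∈ k₂.primeFactors, Real.log p ^ 2)) / 8 *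
              ((∫ u₁ in Ioi (0 : ℝ), ∫ u₂ in Ioi ((((g * g * (k₁ * k₂) : ℕ) : ℝ) / qhat q ^ 2) / u₁),
              Real.exp (-(u₁ + u₂)) / (1 - Real.exp (-(u₁ + u₂))) ^ 2 * Real.log u₂) -
                  (-(Real.log (qhat q ^ 2 / ((g * g * (k₁ * k₂) : ℕ) : ℝ)) ^ 2) / 8 + E₀₁)) +
            (3 * (2 * (Real.log (qhat q) - Real.log g) - Real.log k₁ - Real.log k₂) ^ 2 -
                3 * ((∑ p ∈ k₁.primeFactors, Real.log p ^ 2) + ∑ p ∈ k₂.primeFactors, Real.log p ^ 2)) / 4 *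
              ((∫ u₁ in Ioi (0 : ℝ), ∫ u₂ in Ioi ((((g * g * (k₁ * k₂) : ℕ) : ℝ) / qhat q ^ 2) / u₁),
              Real.exp (-(u₁ + u₂)) / (1 - Real.exp (-(u₁ + u₂))) ^ 2 * Real.log u₂ ^ 2) -
                  (Real.log (qhat q ^ 2 / ((g * g * (k₁ * k₂) : ℕ) : ℝ)) ^ 3 / 24 + 2 * μ₂ * Real.log (qhat q ^ 2 / ((g * g * (k₁ * k₂) : ℕ) : ℝ)) + E₀₂)) +
            (2 * (Real.log (qhat q) - Real.log g) - Real.log k₁ - Real.log k₂) / 2 *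
              ((∫ u₁ in Ioi (0 : ℝ), ∫ u₂ in Ioi ((((g * g * (k₁ * k₂) : ℕ) : ℝ) / qhat q ^ 2) / u₁),
              Real.exp (-(u₁ + u₂)) / (1 - Real.exp (-(u₁ + u₂))) ^ 2 * Real.log u₂ ^ 3) -
                  (-(Real.log (qhat q ^ 2 / ((g * g * (k₁ * k₂) : ℕ) : ℝ)) ^ 4) / 64 - 3 * μ₂ / 2 * Real.log (qhat q ^ 2 / ((g * g * (k₁ * k₂) : ℕ) : ℝ)) ^ 2 + E₀₃)) +
            ((2 * (Real.log (qhat q) - Real.log g) - Real.log k₁ - Real.log k₂) ^ 3 +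
                3 * (2 * (Real.log (qhat q) - Real.log g) - Real.log k₁ - Real.log k₂) * ((∑ p ∈ k₁.primeFactors, Real.log p ^ 2) + ∑ p ∈ k₂.primeFactors, Real.log p ^ 2)) / 8 *
              ((∫ u₁ in Ioi (0 : ℝ), Real.log u₁ * ∫ u₂ in Ioi ((((g * g * (k₁ * k₂) : ℕ) : ℝ) / qhat q ^ 2) / u₁),
              Real.exp (-(u₁ + u₂)) / (1 - Real.exp (-(u₁ + u₂))) ^ 2) -
                  (-(Real.log (qhat q ^ 2 / ((g * g * (k₁ * k₂) : ℕ) : ℝ)) ^ 2) / 8 + E₁₀)) +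
            (3 * (2 * (Real.log (qhat q) - Real.log g) - Real.log k₁ - Real.log k₂) ^ 2 +
                3 * ((∑ p ∈ k₁.primeFactors, Real.log p ^ 2) + ∑ p ∈ k₂.primeFactors, Real.log p ^ 2)) / 4 *
              ((∫ u₁ in Ioi (0 : ℝ), Real.log u₁ * ∫ u₂ in Ioi ((((g * g * (k₁ * k₂) : ℕ) : ℝ) / qhat q ^ 2) / u₁),
              Real.exp (-(u₁ + u₂)) / (1 - Real.exp (-(u₁ + u₂))) ^ 2 * Real.log u₂) -
                  (Real.log (qhat q ^ 2 / ((g * g * (k₁ * k₂) : ℕ) : ℝ)) ^ 3 / 24 - 2 * μ₂ * Real.log (qhat q ^ 2 / ((g * g * (k₁ * k₂) : ℕ) : ℝ)) + E₁₁)) +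
            3 * (2 * (Real.log (qhat q) - Real.log g) - Real.log k₁ - Real.log k₂) / 2 *
              ((∫ u₁ in Ioi (0 : ℝ), Real.log u₁ * ∫ u₂ in Ioi ((((g * g * (k₁ * k₂) : ℕ) : ℝ) / qhat q ^ 2) / u₁),
              Real.exp (-(u₁ + u₂)) / (1 - Real.exp (-(u₁ + u₂))) ^ 2 * Real.log u₂ ^ 2) -
                  (-(Real.log (qhat q ^ 2 / ((g * g * (k₁ * k₂) : ℕ) : ℝ)) ^ 4) / 64 + μ₂ / 2 * Real.log (qhat q ^ 2 / ((g * g * (k₁ * k₂) : ℕ) : ℝ)) ^ 2 + E₁₂)) +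
            ((∫ u₁ in Ioi (0 : ℝ), Real.log u₁ * ∫ u₂ in Ioi ((((g * g * (k₁ * k₂) : ℕ) : ℝ) / qhat q ^ 2) / u₁),
              Real.exp (-(u₁ + u₂)) / (1 - Real.exp (-(u₁ + u₂))) ^ 2 * Real.log u₂ ^ 3) -
                  (Real.log (qhat q ^ 2 / ((g * g * (k₁ * k₂) : ℕ) : ℝ)) ^ 5 / 160 - 2 * μ₄ * Real.log (qhat q ^ 2 / ((g * g * (k₁ * k₂) : ℕ) : ℝ)) + E₁₃))))| ≤
          C * Real.log (qhat q)) :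
    ∀ P : ℝ[X], KMV2000.Admissible P → ∀ Δ' : ℝ, 1 < Δ' → Δ' ≤ Δ →
      ∃ C : ℝ, ∃ q₀ : ℕ, ∀ (q : ℕ) [NeZero q], q₀ ≤ q →
        |(Real.log (qhat q))⁻¹ ^ (1 + 3) * qhat q *
          (∑ c ∈ Icc 1 ⌊qhat q ^ Δ'⌋₊, ∑ g ∈ Icc 1 (⌊qhat q ^ Δ'⌋₊ / c), (μ g : ℝ) * c *
        ∑ k₁ ∈ Icc 1 (⌊qhat q ^ Δ'⌋₊ / (c * g)), ∑ k₂ ∈ Icc 1 (⌊qhat q ^ Δ'⌋₊ / (c * g)),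
          ((μ (c * g * k₁) : ℝ) * ((psi (c * g * k₁))⁻¹ *
              P.eval (Real.log (qhat q ^ Δ' / ((c * g * k₁ : ℕ) : ℝ)) / Real.log (qhat q ^ Δ'))) / ((c * g * k₁ : ℕ) : ℝ)) *
            ((μ (c * g * k₂) : ℝ) * ((psi (c * g * k₂))⁻¹ *
              P.eval (Real.log (qhat q ^ Δ' / ((c * g * k₂ : ℕ) : ℝ)) / Real.log (qhat q ^ Δ'))) / ((c * g * k₂ : ℕ) : ℝ)) *
            (∑ d ∈ k₁.divisors, ∑ e ∈ k₂.divisors,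
              ∫ u₁ in Ioi (0 : ℝ),
                (Real.log (qhat q / ((k₁ / d * (g * e) : ℕ) : ℝ)) + Real.log u₁) ^ 1 *
                ∫ u₂ in Ioi ((((k₁ / d * (g * e) * (g * d * (k₂ / e)) : ℕ) : ℝ) / qhat q ^ 2) / u₁),
                  Real.exp (-(u₁ + u₂)) / (1 - Real.exp (-(u₁ + u₂))) ^ 2 *
                  (Real.log (qhat q / ((g * d * (k₂ / e) : ℕ) : ℝ)) + Real.log u₂) ^ 3)) -
          2 * (π ^ 2 / 6) ^ 2 * (qhat q / (Δ' ^ 2 * Real.log (qhat q) ^ 2)) *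
            (Δ' ^ 2 * (Δ' ^ 2 * ((π ^ 2 / 6) ^ 2 * ((∑ j ∈ Finset.range (5 + 1), ∑ i ∈ Finset.range (j + 1),
            ((5 : ℕ).choose j : ℝ) * (j.choose i : ℝ) * 2 ^ (5 - j) *
              ∫ u in (0 : ℝ)..1, (((Polynomial.C (1 / Δ') - X) ^ (5 - j) * derivative (derivative (X ^ i * P))) *
                derivative (derivative (X ^ (j - i) * P))).eval u) / 160 -
          3 / 16 * (∑ j ∈ Finset.range (1 + 1), ∑ i ∈ Finset.range (j + 1),
            ((1 : ℕ).choose j : ℝ) * (j.choose i : ℝ) * 2 ^ (1 - j) *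
              ∫ u in (0 : ℝ)..1, (((Polynomial.C (1 / Δ') - X) ^ (1 - j) * (-(2 : ℝ) • (X ^ i * P))) *
                (-(2 : ℝ) • (X ^ (j - i) * P))).eval u)))) / (2 * (π ^ 2 / 6) ^ 2))| ≤
          C * qhat q * (Real.log (qhat q))⁻¹ ^ 3 := by
  obtain ⟨𝔎, h𝔎⟩ : ∃ 𝔎 : ℝ → ℝ[X] → ℝ, 𝔎 = fun (lam : ℝ) (P : ℝ[X]) ↦
      (π ^ 2 / 6) ^ 2 * ((∑ j ∈ Finset.range (5 + 1), ∑ i ∈ Finset.range (j + 1),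
            ((5 : ℕ).choose j : ℝ) * (j.choose i : ℝ) * 2 ^ (5 - j) *
              ∫ u in (0 : ℝ)..1, (((Polynomial.C lam - X) ^ (5 - j) * derivative (derivative (X ^ i * P))) *
                derivative (derivative (X ^ (j - i) * P))).eval u) / 160 -
          3 / 16 * (∑ j ∈ Finset.range (1 + 1), ∑ i ∈ Finset.range (j + 1),
            ((1 : ℕ).choose j : ℝ) * (j.choose i : ℝ) * 2 ^ (1 - j) *
              ∫ u in (0 : ℝ)..1, (((Polynomial.C lam - X) ^ (1 - j) * (-(2 : ℝ) • (X ^ i * P))) *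
                (-(2 : ℝ) • (X ^ (j - i) * P))).eval u)) := ⟨_, rfl⟩
  have hA : ∀ P : ℝ[X], P.coeff 0 = 0 → P.coeff 1 = 0 → ∀ lam : ℝ, 0 ≤ lam → lam ≤ 1 →
      ∀ E₀₀ E₀₁ E₀₂ E₀₃ E₁₀ E₁₁ E₁₂ E₁₃ μ₂ μ₄ : ℝ, ∃ C : ℝ, ∀ M : ℝ, 3 ≤ M →
      |∑ c ∈ Icc 1 ⌊M⌋₊, ∑ g ∈ Icc 1 (⌊M⌋₊ / c), (μ g : ℝ) * c *
        ∑ k₁ ∈ Icc 1 (⌊M⌋₊ / (c * g)), ∑ k₂ ∈ Icc 1 (⌊M⌋₊ / (c * g)),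
          ((μ (c * g * k₁) : ℝ) * ((psi (c * g * k₁))⁻¹ *
              P.eval (Real.log (M / ((c * g * k₁ : ℕ) : ℝ)) / Real.log M)) / ((c * g * k₁ : ℕ) : ℝ)) *
            ((μ (c * g * k₂) : ℝ) * ((psi (c * g * k₂))⁻¹ *
              P.eval (Real.log (M / ((c * g * k₂ : ℕ) : ℝ)) / Real.log M)) / ((c * g * k₂ : ℕ) : ℝ)) *
            ((1 / 160) * ((k₁.divisors.card : ℝ) * (k₂.divisors.card : ℝ) *
                (2 * (lam * Real.log M) - 2 * Real.log g - Real.log k₁ - Real.log k₂) ^ 5) +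
              (E₀₀ / 16) * ((k₁.divisors.card : ℝ) * (k₂.divisors.card : ℝ) *
                (2 * (lam * Real.log M) - 2 * Real.log g - Real.log k₁ - Real.log k₂) ^ 4) +
              (3 * E₀₁ / 8 + E₁₀ / 8) * ((k₁.divisors.card : ℝ) * (k₂.divisors.card : ℝ) *
                (2 * (lam * Real.log M) - 2 * Real.log g - Real.log k₁ - Real.log k₂) ^ 3) +
              (3 * E₀₂ / 4 + 3 * E₁₁ / 4) * ((k₁.divisors.card : ℝ) * (k₂.divisors.card : ℝ) *
                (2 * (lam * Real.log M) - 2 * Real.log g - Real.log k₁ - Real.log k₂) ^ 2) +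
              (E₀₃ / 2 + 3 * E₁₂ / 2 - 2 * μ₄) * ((k₁.divisors.card : ℝ) * (k₂.divisors.card : ℝ) *
                (2 * (lam * Real.log M) - 2 * Real.log g - Real.log k₁ - Real.log k₂) ^ 1) +
              E₁₃ * ((k₁.divisors.card : ℝ) * (k₂.divisors.card : ℝ) *
                (2 * (lam * Real.log M) - 2 * Real.log g - Real.log k₁ - Real.log k₂) ^ 0) +
              (-3 * E₀₁ / 8 + 3 * E₁₀ / 8 - 3 * μ₂) * ((k₁.divisors.card : ℝ) * (∑ p ∈ k₁.primeFactors, Real.log p ^ 2) * (k₂.divisors.card : ℝ) *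
                (2 * (lam * Real.log M) - 2 * Real.log g - Real.log k₁ - Real.log k₂) ^ 1) +
              (-3 * E₀₂ / 4 + 3 * E₁₁ / 4) * ((k₁.divisors.card : ℝ) * (∑ p ∈ k₁.primeFactors, Real.log p ^ 2) * (k₂.divisors.card : ℝ) *
                (2 * (lam * Real.log M) - 2 * Real.log g - Real.log k₁ - Real.log k₂) ^ 0) +
              (-3 * E₀₁ / 8 + 3 * E₁₀ / 8 - 3 * μ₂) * ((k₁.divisors.card : ℝ) * ((k₂.divisors.card : ℝ) * ∑ p ∈ k₂.primeFactors, Real.log p ^ 2) *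
                (2 * (lam * Real.log M) - 2 * Real.log g - Real.log k₁ - Real.log k₂) ^ 1) +
              (-3 * E₀₂ / 4 + 3 * E₁₁ / 4) * ((k₁.divisors.card : ℝ) * ((k₂.divisors.card : ℝ) * ∑ p ∈ k₂.primeFactors, Real.log p ^ 2) *
                (2 * (lam * Real.log M) - 2 * Real.log g - Real.log k₁ - Real.log k₂) ^ 0) +
              (-3 / 16) * ((k₁.divisors.card : ℝ) * (∑ p ∈ k₁.primeFactors, Real.log p ^ 2) *
                ((k₂.divisors.card : ℝ) * (∑ p ∈ k₂.primeFactors, Real.log p ^ 2)) *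
                (2 * (lam * Real.log M) - 2 * Real.log g - Real.log k₁ - Real.log k₂) ^ 1) +
              (-3 * E₀₀ / 8) * ((k₁.divisors.card : ℝ) * (∑ p ∈ k₁.primeFactors, Real.log p ^ 2) *
                ((k₂.divisors.card : ℝ) * (∑ p ∈ k₂.primeFactors, Real.log p ^ 2)) *
                (2 * (lam * Real.log M) - 2 * Real.log g - Real.log k₁ - Real.log k₂) ^ 0) +
              (-1 / 32) * ((k₁.divisors.card : ℝ) * (3 * (∑ p ∈ k₁.primeFactors, Real.log p ^ 2) ^ 2 - 2 * ∑ p ∈ k₁.primeFactors, Real.log p ^ 4) *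
                (k₂.divisors.card : ℝ) * (2 * (lam * Real.log M) - 2 * Real.log g - Real.log k₁ - Real.log k₂) ^ 1) +
              (-E₀₀ / 16) * ((k₁.divisors.card : ℝ) * (3 * (∑ p ∈ k₁.primeFactors, Real.log p ^ 2) ^ 2 - 2 * ∑ p ∈ k₁.primeFactors, Real.log p ^ 4) *
                (k₂.divisors.card : ℝ) * (2 * (lam * Real.log M) - 2 * Real.log g - Real.log k₁ - Real.log k₂) ^ 0) +
              (-1 / 32) * ((k₁.divisors.card : ℝ) * ((k₂.divisors.card : ℝ) *
                (3 * (∑ p ∈ k₂.primeFactors, Real.log p ^ 2) ^ 2 - 2 * ∑ p ∈ k₂.primeFactors, Real.log p ^ 4)) *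
                (2 * (lam * Real.log M) - 2 * Real.log g - Real.log k₁ - Real.log k₂) ^ 1) +
              (-E₀₀ / 16) * ((k₁.divisors.card : ℝ) * ((k₂.divisors.card : ℝ) *
                (3 * (∑ p ∈ k₂.primeFactors, Real.log p ^ 2) ^ 2 - 2 * ∑ p ∈ k₂.primeFactors, Real.log p ^ 4)) *
                (2 * (lam * Real.log M) - 2 * Real.log g - Real.log k₁ - Real.log k₂) ^ 0)) -
        𝔎 lam P * Real.log M ^ 2| ≤ C * Real.log M := by
    intro P' hP0 hP1 lam hl0 hl1 E₀₀ E₀₁ E₀₂ E₀₃ E₁₀ E₁₁ E₁₂ E₁₃ μ₂ μ₄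
    subst h𝔎
    exact orderOneThreePoly P' hP0 hP1 lam hl0 hl1 E₀₀ E₀₁ E₀₂ E₀₃ E₁₀ E₁₁ E₁₂ E₁₃ μ₂ μ₄
  have h := orderOneThree_target_of_poly_of_remainder 𝔎 hA hR
  subst h𝔎
  beta_reduce at h
  exact h

end Summit.Parity.GeneralizedHardyLittlewood.Theorems.MomentsBeyondDiagonal.DiagKernel

end
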